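import Literature.AlgebraicGeometry.AbelianSchemes.AbelianSchemeSteinOfNoetherian
import Literature.AlgebraicGeometry.Modules.PicardGroupThickeningTorsorFlat
import Mathlib.AlgebraicGeometry.Noetherian
import HarnessLib

/-!
# Rank-one liftings along `A′_C ⊂ A′_{C′}` form a torsor under `H¹(𝓘)` for a principal small extension `C′ ↠ C` of Artinian
# local rings over the base of an abelian scheme (Hartshorne, *Deformation Theory*, Thm. 6.4 (b)–(d), assembled with Stein)

Layer `Literature/AlgebraicGeometry/AbelianSchemes`, namespace `Literature.AlgebraicGeometry.AbelianSchemes.AbelianSchemeOver`.  THEOREMS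
ONLY (no definition, no named fact, no instance, no notation, no `sorry`).  Cell `hodgecm-mathlib` (D-0151), F-3 (M) grandchild line
`Cruxes/HDel/Lines/F3DualAbelianSchemeMc`, (N3′) Artinian tower (road (R-a′), B-plan1 (g19) 2026-08-30 20:24:23Z), inner letter **S-b**
`stub_F3McN3Sb` of B-p02 (g16)'s sub-skeleton `F3DualAbelianSchemeMcN3.subskeleton-v0` (:66; B-typ04 (g15) STUBMENU-F3McN3-inner v0.1) —
author B-p03 (g20).  HC_CM is proved only modulo the 7 printed citations until rung 0 closes; nothing here is about HC.

NOTHING NEW is proved about schemes: the file FEEDS the abelian-scheme situation into the tree's Hartshorne-6.4 library.  For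
`A′ := A.baseChange p` (an abelian scheme over `S′`), a principal small extension `q : C′ ↠ C` of Artinian local rings (`ker q = (t₀)`,
`t₀ 𝔪_{C′} = 0`, `t₀ ∈ 𝔪_{C′}`) with structure map `c′ : Spec C′ → S′`, the thickening `i : X = A′ ×_{S′} Spec C ↪ X′ = A′ ×_{S′} Spec C′`
(`= (A′.X ◁ ι₀).left`):
* `X → Spec C` is FLAT (base change of the smooth `A′ → S′`) and sits in the cartesian square over `Spec C → Spec C′`
  (`isPullback_whiskerLeft_left_spec`);
* the closed fibre `X ×_C Spec(C/𝔪) ≅ A′ ×_{S′} Spec(C/𝔪)` is STEIN: `C/𝔪 → Γ(X ×_C Spec(C/𝔪), 𝒪)` is bijective (★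
  `AbelianSchemeOver.baseChange_appTop_bijective` over the locally Noetherian `S′`, transported along Mathlib's `pullbackLeftPullbackSndIso`)
  — `specStructureMap_quotientFibreSnd_bijective_of_abelianScheme`;
* hence ★ `Modules.rankOneLiftings_free_of_flat` (Thm. 6.4 (d) ⇒ (c): FREE) and ★
  `Modules.exists_detClassH_eq_add_map_truncExp_of_pullback_iso` (Thm. 6.4 (b): TRANSITIVE) give **`stub_F3McN3Sb`'s letter**
  `existsUnique_detClassH_eq_add_truncExp_smallExtension`: if a rank-one `E` on `X` lifts at all, any two rank-one liftings `L′`, `L″`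
  differ by a UNIQUE `t ∈ H¹(X′, 𝓘)`: `[L″] = [L′] + H¹(truncExp)(t)` in `H¹(X′, 𝒪^×)` (Mathlib sheaf cohomology currency of the ★ files:
  `detClassH`, `idealSheafAb i`, `truncExp i`).
[Hartshorne2010] §6 Thm. 6.4 (b) «`H¹(J ⊗ 𝒪_X)` acts transitively», (c) «torsor iff `H⁰(𝒪^*_{X′}) → H⁰(𝒪^*_X)` onto», (d) «sufficient:
`H⁰(𝒪_{X₀}) = k`»; here `H⁰(𝒪_{A′_κ}) = κ` by Stein [GortzWedhorn2023, Cor. 24.63].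

## References
* [Hartshorne2010] R. Hartshorne, *Deformation Theory*, GTM 257 (2010), §6 Thm. 6.4 (b)–(d), Rem. 6.4.1 (pp. 50–51); (6.1) p. 46.
* [GortzWedhorn2023] U. Görtz, T. Wedhorn, *Algebraic Geometry II* (2023), Cor. 24.63 (p. 404) (abelian schemes are universally Stein).
* [MumfordAV1970] D. Mumford, *Abelian Varieties* (1970), §13 (proof of the Theorem, pp. 125–130).
-/

noncomputable section

universe u

open CategoryTheory CategoryTheory.Limits AlgebraicGeometry MonoidalCategory IsLocalRing

namespace Literature.AlgebraicGeometry.AbelianSchemes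

open Literature.AlgebraicGeometry.Motives Literature.AlgebraicGeometry.Modules Literature.AlgebraicGeometry.Deformation

namespace AbelianSchemeOver

/-! ## §1 Base-change squares of `A′ ⊗ -` and Stein on the closed fibre -/

section Squares

variable {S' : Scheme.{u}} (B : Over S') {T₀ T : Over S'} (τ : T₀ ⟶ T)

/-- `(B ⊗ T₀).left → (B ⊗ T).left` is the base change of `T₀.left → T.left` along the projection `(B ⊗ T).left → T.left` (the tensor
product of `Over S′` is the fibre product over `S′`). [cite: Hartshorne2010, §6 (6.1), p. 46 (`X' ×_{C'} C`)] -/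
theorem isPullback_whiskerLeft_left_snd :
    IsPullback (B ◁ τ).left (Limits.pullback.snd B.hom T₀.hom) (Limits.pullback.snd B.hom T.hom) τ.left := by
  refine IsPullback.of_right ?_ (Over.whiskerLeft_left_snd τ) (IsPullback.of_hasPullback B.hom T.hom)
  rw [Over.whiskerLeft_left_fst, Over.w τ]
  exact IsPullback.of_hasPullback B.hom T₀.hom

end Squares

section Stein

variable {S S' : Scheme.{u}} [IsLocallyNoetherian S'] (A' : AbelianSchemeOver S')

/-- **The closed fibre of `X = A′ ×_{S′} Spec C → Spec C` is STEIN in the currency of ★ `Deformation.specStructureMap` ∕ `quotientFibreSnd`**: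
for any `c : Spec C → S′` and any ideal `J ⊴ C`, `C/J → Γ(X ×_C Spec(C/J), 𝒪)` is bijective — `X ×_C Spec(C/J) ≅ A′ ×_{S′} Spec(C/J)`
(Mathlib `pullbackLeftPullbackSndIso`) and ★ `AbelianSchemeOver.baseChange_appTop_bijective` (abelian schemes over a locally Noetherian base are
universally Stein). [cite: GortzWedhorn2023, Cor. 24.63 (p. 404)] [cite: Hartshorne2010, §6 Thm. 6.4 (d), p. 50 (`H⁰(𝒪_{X₀}) = k`)] -/
theorem specStructureMap_quotientFibreSnd_bijective {C : Type u} [CommRing C] (c : Spec (.of C) ⟶ S') (J : Ideal C) :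
    Function.Bijective (specStructureMap (quotientFibreSnd (Limits.pullback.snd A'.X.hom c) J)) := by
  -- the comparison `X ×_C Spec(C/J) ≅ A′ ×_{S′} Spec(C/J)` and Stein for the latter
  let mkJ : Spec (.of (C ⧸ J)) ⟶ Spec (.of C) := Spec.map (CommRingCat.ofHom (Ideal.Quotient.mk J))
  let e := pullbackLeftPullbackSndIso A'.X.hom c mkJ
  have hSt : Function.Bijective (Limits.pullback.snd A'.X.hom (mkJ ≫ c)).appTop := A'.baseChange_appTop_bijective (mkJ ≫ c)
  have hsnd : quotientFibreSnd (Limits.pullback.snd A'.X.hom c) J = e.hom ≫ Limits.pullback.snd A'.X.hom (mkJ ≫ c) :=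
    (pullbackLeftPullbackSndIso_hom_snd A'.X.hom c mkJ).symm
  -- `specStructureMap h = h♯ ∘ ΓSpecIso⁻¹`, and `h♯ = e♯ ∘ snd♯`
  have hfun : ∀ x, specStructureMap (quotientFibreSnd (Limits.pullback.snd A'.X.hom c) J) x =
      e.hom.appTop ((Limits.pullback.snd A'.X.hom (mkJ ≫ c)).appTop ((Scheme.ΓSpecIso (.of (C ⧸ J))).inv x)) := by
    intro x
    rw [specStructureMap_apply]
    have h1 := congrArg (fun m => Scheme.Hom.appTop m ((Scheme.ΓSpecIso (.of (C ⧸ J))).inv x)) hsnd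
    dsimp only at h1
    rw [h1, Scheme.Hom.comp_appTop]
    rfl
  have hcomp : (⇑(specStructureMap (quotientFibreSnd (Limits.pullback.snd A'.X.hom c) J)) : C ⧸ J → _) =
      ⇑(e.hom.appTop.hom) ∘ (⇑(Limits.pullback.snd A'.X.hom (mkJ ≫ c)).appTop.hom ∘ ⇑(Scheme.ΓSpecIso (.of (C ⧸ J))).inv.hom) :=
    funext hfun
  rw [hcomp]
  haveI : IsIso e.hom.appTop := by
    change IsIso (Scheme.Γ.map e.hom.op)
    infer_instance
  exact (ConcreteCategory.bijective_of_isIso e.hom.appTop).comp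
    (hSt.comp (ConcreteCategory.bijective_of_isIso (Scheme.ΓSpecIso (.of (C ⧸ J))).inv))

end Stein

/-! ## §2 The S-b letter: rank-one liftings along `A′_C ⊂ A′_{C′}` form a torsor under `H¹(𝓘)` -/

set_option maxHeartbeats 400000 in
/-- **S-b — RANK-ONE LIFTINGS ALONG `A′_C ⊂ A′_{C′}` FORM A TORSOR UNDER `H¹(𝓘)`** (Hartshorne, *Deformation Theory*, Thm. 6.4 (b)(c)(d)
for the flat deformation `A′ ×_{S′} Spec C′ → Spec C′` of the abelian scheme `A′ = A.baseChange p` along a principal small extension `C′ ↠ C`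
of Artinian local rings over `S′`): if a rank-one `E` on `X = A′_C` lifts to `X′ = A′_{C′}` at all, then for any two rank-one liftings
`L′`, `L″` there is a UNIQUE `t ∈ H¹(X′, 𝓘)` with `[L″] = [L′] + H¹(truncExp)(t)` in `H¹(X′, 𝒪^*)` — transitive by ★
`Modules.exists_detClassH_eq_add_map_truncExp_of_pullback_iso` (6.4 (b)); free by ★ `Modules.rankOneLiftings_free_of_flat` (6.4 (d): `X → Spec C`
is flat and `H⁰(𝒪_{A′_κ}) = κ` by Stein, so global units lift).  The letter `stub_F3McN3Sb` of the (Mc) N3′ sub-skeleton VERBATIM.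
[cite: Hartshorne2010, §6 Thm. 6.4 (b)–(d) and Rem. 6.4.1 (pp. 50–51)] [cite: GortzWedhorn2023, Cor. 24.63 (p. 404)] -/
theorem existsUnique_detClassH_eq_add_truncExp_smallExtension :
    ∀ (R : Type) [CommRing R] [IsNoetherianRing R] [Algebra ℚ R] (A : AbelianSchemeOver (Spec (.of R)))
    {S' : Scheme.{0}} [IsAffine S'] (p : S' ⟶ Spec (.of R)) [IsFinite p] [Etale p] [Surjective p]
    (C' C : Type) [CommRing C'] [IsLocalRing C'] [IsArtinianRing C'] [CommRing C] [IsLocalRing C] [IsArtinianRing C]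
    (q : C' →+* C) (_hq : Function.Surjective q) (t₀ : C') (_hker : RingHom.ker q = Ideal.span {t₀})
    (_htm : ∀ m ∈ IsLocalRing.maximalIdeal C', t₀ * m = 0) (_ht₀m : t₀ ∈ IsLocalRing.maximalIdeal C')
    (c' : Spec (.of C') ⟶ S')
    (ι₀ : Over.mk (Spec.map (CommRingCat.ofHom q) ≫ c') ⟶ Over.mk c') (_hι : ι₀.left = Spec.map (CommRingCat.ofHom q))
    [IsFirstOrderThickening ((A.baseChange p).X ◁ ι₀).left]
    (E : ((A.baseChange p).X ⊗ Over.mk (Spec.map (CommRingCat.ofHom q) ≫ c')).left.Modules), HasRank E 1 →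
    (∃ (L' : ((A.baseChange p).X ⊗ Over.mk c').left.Modules) (_ : HasRank L' 1),
        Nonempty ((Scheme.Modules.pullback ((A.baseChange p).X ◁ ι₀).left).obj L' ≅ E)) →
    ∀ (L' L'' : ((A.baseChange p).X ⊗ Over.mk c').left.Modules) (hL' : HasRank L' 1) (hL'' : HasRank L'' 1),
      Nonempty ((Scheme.Modules.pullback ((A.baseChange p).X ◁ ι₀).left).obj L' ≅ E) →
      Nonempty ((Scheme.Modules.pullback ((A.baseChange p).X ◁ ι₀).left).obj L'' ≅ E) →
      ∃! t : (idealSheafAb ((A.baseChange p).X ◁ ι₀).left).H 1,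
        detClassH (HasRank.isFiniteLocallyFree' hL'') =
          detClassH (HasRank.isFiniteLocallyFree' hL') + Sheaf.H.map (truncExp ((A.baseChange p).X ◁ ι₀).left) 1 t := by
  intro R _ _ _ A S' _ p _ _ _ C' C _ _ _ _ _ _ q hq t₀ hker htm ht₀m c' ι₀ hι hfo E hE hex L' L'' hL' hL'' hL'E hL''E
  obtain ⟨e₁⟩ := hL'E
  obtain ⟨e₂⟩ := hL''E
  -- TRANSITIVE (Thm. 6.4 (b)): some `t` (the thickening instance is passed explicitly)
  obtain ⟨t, ht⟩ := @exists_detClassH_eq_add_map_truncExp_of_pullback_iso _ _ ((A.baseChange p).X ◁ ι₀).left hfo _ _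
    hL' hL'' (e₁ ≪≫ e₂.symm)
  refine ⟨t, ht, fun t' ht' => ?_⟩
  -- FREE (Thm. 6.4 (d)): the data of ★ `rankOneLiftings_free_of_flat` for `X = A′_C → Spec C`, `X′ = A′_{C′} → Spec C′`
  haveI : IsLocallyNoetherian S' := LocallyOfFiniteType.isLocallyNoetherian p
  haveI : Smooth (A.baseChange p).X.hom := (A.baseChange p).isSmooth
  haveI : Flat (A.baseChange p).X.hom := inferInstance
  have hflat : Flat (Limits.pullback.snd (A.baseChange p).X.hom (Spec.map (CommRingCat.ofHom q) ≫ c')) :=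
    MorphismProperty.pullback_snd (P := @Flat) _ _ inferInstance
  have Hi : IsPullback ((A.baseChange p).X ◁ ι₀).left
      (Limits.pullback.snd (A.baseChange p).X.hom (Spec.map (CommRingCat.ofHom q) ≫ c'))
      (Limits.pullback.snd (A.baseChange p).X.hom c') (Spec.map (CommRingCat.ofHom q)) := by
    have h := isPullback_whiskerLeft_left_snd (A.baseChange p).X ι₀
    rw [hι] at h
    exact h
  have hX₀ := (A.baseChange p).specStructureMap_quotientFibreSnd_bijective (Spec.map (CommRingCat.ofHom q) ≫ c')
    (maximalIdeal C)
  have hfree := @rankOneLiftings_free_of_flat _ _ C' C _ _ _ (Limits.pullback.snd (A.baseChange p).X.hom c') q hq t₀ hker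
    ((A.baseChange p).X ◁ ι₀).left (Limits.pullback.snd (A.baseChange p).X.hom (Spec.map (CommRingCat.ofHom q) ≫ c')) ht₀m Hi
    hfo _ _ hflat E hX₀ hex L' L' hL' hL' (t' - t) ⟨e₁⟩
  -- `[L′] = [L′] + H¹(truncExp)(t′ − t)` from the two descriptions of `[L″]`
  have hdiff : detClassH (HasRank.isFiniteLocallyFree' hL') =
      detClassH (HasRank.isFiniteLocallyFree' hL') + Sheaf.H.map (truncExp ((A.baseChange p).X ◁ ι₀).left) 1 (t' - t) := by
    rw [map_sub, ← add_sub_assoc, ← ht', ht, add_sub_cancel_right]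
  exact sub_eq_zero.mp (hfree hdiff ⟨Iso.refl _⟩)

end AbelianSchemeOver

end Literature.AlgebraicGeometry.AbelianSchemes

end
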